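import Literature.Computability.QuantumComplexity.PhaseGadgetAssembly
import HarnessLib

/-!
# The assembled phase gadget with a label-dependent phase

Topic `Literature/Computability/QuantumComplexity`; a generalisation of
`PhaseGadgetAssembly.phaseGadget_implOn` in which the unit scalar `u z` and the flag semantics
`σ rb z n` may depend on the whole input label `z` (off the distinguished wire `t`): the form in which
the AJL controlled phase is conditioned at once on the Hadamard-test qubit, the one-hot letter bit and
the three vertex registers (`JonesLocalGateCircuit.ECond`). Statement and proof follow
`phaseGadget_implOn` (`phaseGadget_implOn_gen`).

## References

* D. W. Berry, A. M. Childs, R. Cleve, R. Kothari, R. D. Somma, STOC 2014, Lemma 3.1 and proof of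
  Thm. 1.1 [BerryEtAl2014].
* D. Aharonov, V. Jones, Z. Landau, Algorithmica 55 (2009), Claim 4.1 [AharonovJonesLandau2009].
-/

noncomputable section

namespace Literature.Computability.QuantumComplexity

open _root_.Matrix Finset Cryptography RevSim
open scoped Matrix.Norms.L2Operator

variable {N : ℕ}

/-- **The assembled phase gadget, label-dependent phase.** See the module docstring. [cite: BerryEtAl2014, Lemma 3.1 and proof of Thm. 1.1]
[cite: AharonovJonesLandau2009, Claim 4.1] -/
theorem phaseGadget_implOn_gen {r t Fz : Fin N} {as region hs : List (Fin N)} (ops : List (ClOp (Fin N)))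
    (hwf : ∀ op ∈ ops, op.WF)
    (hnd : (r :: as).Nodup) (ht : t ∉ r :: as) (htr : t ∉ region)
    (hrt : ∀ op ∈ ops, op.target ≠ r)
    (hlen : (as ++ region).length = hs.length) (hne : hs ≠ []) (hsnd : hs.Nodup) (hrhs : r ∉ hs)
    (hls : ∀ l ∈ as ++ region, l ∉ hs ∧ l ≠ r) (hlsnd : (r :: (as ++ region)).Nodup)
    (hwfR : ∀ op ∈ reflectProg r (as ++ region) hs, op.WF)
    (hsw : ∀ h ∈ hs, h ∉ phaseSandwichWires (r :: as) ops [r] [Fz])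
    (σ : Bool → QReg N → ℕ → Bool)
    (hflag : ∀ z, z ∈ cleanOn (r :: as ++ region) → ∀ (rb : Bool) (n : ℕ), n < 2 ^ as.length →
      clEval ops (writeNat as (Function.update z r rb) n) Fz = σ rb z n)
    (u : QReg N → ℂ) (hu : ∀ z, ‖u z‖ = 1) (hut : ∀ z b, u (Function.update z t b) = u z) {η : ℝ} (hη : 0 ≤ η)
    (hent : ∀ z : QReg N,
      ‖(((1 : ℂ) - 2 * (((Finset.range (2 ^ as.length)).filter fun n => σ false z n = true).card : ℂ) / 2 ^ as.length) +
        Complex.I * ((1 : ℂ) - 2 * (((Finset.range (2 ^ as.length)).filter fun n => σ true z n = true).card : ℂ) / 2 ^ as.length)) -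
        (-(u z))‖ ≤ η) :
    ImplOn (cleanOn (r :: as ++ region) ∩ cleanOn hs)
      ((oaaWordCircuit (phaseSandwichCircuit (r :: as) ops hwf [r] [Fz]) (reflectCircuit r (as ++ region) hs hne hwfR)).toMatrix 0)
      (ctrlGate t (fun z => u z • (1 : Matrix (QReg 1) (QReg 1) ℂ))) (9 * Real.sqrt (2 * η)) := by
  set P : Set (QReg N) := cleanOn (r :: as ++ region) with hPdef
  set GW := phaseSandwichCircuit (r :: as) ops hwf [r] [Fz] with hGW
  set GR := reflectCircuit r (as ++ region) hs hne hwfR with hGR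
  set W := GW.toMatrix 0 with hW
  have hR : ∀ ψ, SuppIn (cleanOn hs) ψ → GR.toMatrix 0 *ᵥ ψ = (1 - (2 : ℂ) • projOn P) *ᵥ ψ := by
    intro ψ hψ
    have := reflectCircuit_mulVec_eq 0 hlen hne hsnd hrhs hls hlsnd hwfR ψ hψ
    rw [hGR, this, hPdef]; rfl
  have hoff : ∀ g ∈ GW.gates, ∀ a ∈ hs, a ∉ g.wires := fun g hg a ha hx =>
    hsw a ha (mem_phaseSandwichWires_of_mem_gates (r :: as) ops hwf [r] [Fz] hg hx)
  have hWS : PreservesSupp (cleanOn hs) (GW.toMatrix 0) := preservesSupp_toMatrix_of_offWires 0 GW.gates hoff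
  have hWS' : PreservesSupp (cleanOn hs) (GW.inv.toMatrix 0) := preservesSupp_inv_toMatrix_of_offWires 0 GW hoff
  have htP : t ∉ r :: as ++ region := by
    simp only [List.cons_append, List.mem_cons, List.mem_append, not_or] at ht ⊢; exact ⟨ht.1, ht.2, htr⟩
  have hP : ∀ x b, Function.update x t b ∈ P ↔ x ∈ P := fun x b => update_mem_cleanOn_iff htP x b
  have hWu : W ∈ Matrix.unitaryGroup (QReg N) ℂ := QCircuit.toMatrix_mem_unitaryGroup_holds cliffordT_isUnitary_holds 0 GW
  have hWmat : W = hadLayerRev (r :: as) * phaseDiag (phaseKickExp ops [r] [Fz]) * hadLayer (r :: as) := by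
    rw [hW, hGW, phaseSandwichCircuit_toMatrix]
  have hclean : ∀ {x : QReg N}, x ∈ P → ∀ i ∈ r :: as, x i = false := fun hx i hi =>
    hx i (by simp only [List.cons_append, List.mem_cons, List.mem_append] at hi ⊢; tauto)
  -- the selector wire is untouched by the flag program
  have hsel : ∀ y, clEval ops y r = y r := fun y => clEval_apply_of_forall_target_ne ops y fun op hop => hrt op hop
  have hr : r ∉ as := (List.nodup_cons.1 hnd).1
  -- the exponent on the two halves
  have hg : ∀ {z : QReg N}, z ∈ P → ∀ (rb : Bool) (n : ℕ), n < 2 ^ as.length →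
      phaseKickExp ops [r] [Fz] (writeNat as (Function.update z r rb) n) = rb.toNat + 2 * (σ rb z n).toNat := by
    intro z hz rb n hn
    rw [phaseKickExp, countOn, countOn, List.countP_cons, List.countP_nil, zero_add, List.countP_cons, List.countP_nil, zero_add,
      hsel, writeNat_apply_of_not_mem as _ _ hr, Function.update_self, hflag z hz rb n hn]
    cases rb <;> cases σ _ z n <;> simp
  have hent2 : ∀ {x z : QReg N}, x ∈ P → z ∈ P → 2 * W x z =
      if EqOff (r :: as) z x then
        ((1 : ℂ) - 2 * (((Finset.range (2 ^ as.length)).filter fun n => σ false z n = true).card : ℂ) / 2 ^ as.length) +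
          Complex.I * ((1 : ℂ) - 2 * (((Finset.range (2 ^ as.length)).filter fun n => σ true z n = true).card : ℂ) / 2 ^ as.length)
      else 0 := by
    intro x z hx hz
    rw [hWmat]
    exact two_mul_sandwich_diag_entry_of_sign hnd _ (hclean hx) (hclean hz) _ _
      (fun n hn => by rw [hg hz false n hn, Bool.toNat_false, zero_add]) (fun n hn => by rw [hg hz true n hn, Bool.toNat_true])
  -- on `P`, agreement off `r :: as` is equality
  have heq : ∀ {x z : QReg N}, x ∈ P → z ∈ P → EqOff (r :: as) z x → z = x := by
    intro x z hx hz h; funext j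
    by_cases hj : j ∈ r :: as
    · rw [hclean hz j hj, hclean hx j hj]
    · exact h j hj
  have hWloc : ∀ x z, x ∈ P → z ∈ P → ¬ EqOff [t] z x → W x z = 0 := by
    intro x z hx hz hzx
    have e2 := hent2 hx hz
    rw [if_neg (fun h => hzx (by rw [heq hx hz h]; exact eqOff_refl _))] at e2
    simpa using e2
  have hWent : ∀ x z, x ∈ P → z ∈ P → EqOff [t] z x →
      ‖2 * W x z - (fun z => -(u z • (1 : Matrix (QReg 1) (QReg 1) ℂ))) z (fun _ => x t) (fun _ => z t)‖ ≤ η := by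
    intro x z hx hz hzx
    have e2 := hent2 hx hz
    by_cases hxz : EqOff (r :: as) z x
    · have hzx' : z = x := heq hx hz hxz
      subst hzx'
      rw [if_pos hxz] at e2
      rw [e2]
      simp only [Matrix.neg_apply, Matrix.smul_apply, Matrix.one_apply_eq, smul_eq_mul, mul_one]
      exact hent z
    · rw [if_neg hxz] at e2
      have hne : x t ≠ z t := by
        intro htt; apply hxz
        rw [eqOff_singleton_iff.1 hzx, ← htt, Function.update_eq_self]
        exact eqOff_refl _
      have hmat : (fun z => -(u z • (1 : Matrix (QReg 1) (QReg 1) ℂ))) z (fun _ => x t) (fun _ => z t) = 0 := by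
        simp only [Matrix.neg_apply, Matrix.smul_apply, smul_eq_mul]
        rw [Matrix.one_apply_ne (fun h => hne (congrFun h 0)), mul_zero, neg_zero]
      have h0 : W x z = 0 := by simpa using e2
      rw [hmat, h0]; simp [hη]
  have hUu : ∀ z : QReg N, (fun z => -(u z • (1 : Matrix (QReg 1) (QReg 1) ℂ))) z ∈ Matrix.unitaryGroup (QReg 1) ℂ := by
    intro z
    refine Matrix.mem_unitaryGroup_iff.2 ?_
    have hn : u z * star (u z) = 1 := by
      rw [Complex.star_def, Complex.mul_conj, Complex.normSq_eq_norm_sq, hu]; norm_num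
    simp only [star_neg, star_smul, star_one, neg_mul_neg, smul_mul_smul_comm, mul_one, hn, one_smul]
  have hUt : ∀ (z : QReg N) (b : Bool),
      (fun z => -(u z • (1 : Matrix (QReg 1) (QReg 1) ℂ))) (Function.update z t b) =
        (fun z => -(u z • (1 : Matrix (QReg 1) (QReg 1) ℂ))) z := fun z b => by
    simp only [hut]
  have hOAA := implOn_oaaOp_of_entries (t := t) (U := fun z => -(u z • (1 : Matrix (QReg 1) (QReg 1) ℂ))) hP hWu hUu hUt hη
    hWloc hWent
  have hfin := implOn_oaaWordCircuit GW GR P (cleanOn hs) hR hWS hWS' hOAA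
  rw [← ctrlGate_neg] at hfin
  simpa only [neg_neg] using hfin

end Literature.Computability.QuantumComplexity

end
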